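import Mathlib.LinearAlgebra.BilinearForm.Properties
import Mathlib.Algebra.CharZero.Defs
import Mathlib.Tactic.Module
import Mathlib.Tactic.FieldSimp
import HarnessLib

/-!
# Zarhin's Lie-algebra lemma, orthogonal case: an irreducible skew Lie algebra containing the Hodge element `e ∧ f` contains `so(W)` (Zarhin's theorem, step 6, totally real case)

Pure linear algebra over a field `K` of characteristic `0`. Let `B` be a symmetric bilinear form
on `V`, and for `x, y ∈ V` let `x ∧ y ∈ End(V)` be the skew endomorphism
`w ↦ B(y, w) x - B(x, w) y` (the standard identification `Λ² V → so(V, B)`; written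
`so⟦x, y⟧` below, a local notation, not a definition). Let `S ⊆ End(V)` be a subspace closed
under commutators, consisting of `B`-skew endomorphisms, preserving a subspace `W`, and let
`e, f ∈ W` be isotropic with `B(e, f) = 1` such that the "Hodge element" `e ∧ f` lies in `S` and
`W` is `S`-irreducible (its only `S`-stable subspaces are `0` and `W`). THEN `x ∧ y ∈ S` for all
`x, y ∈ W` (`wedge_mem_of_irreducible`), i.e. `S ⊇ so(W, B|_W)` extended by zero.

This is the heart of Zarhin's "comparison of dimensions" in the proof of his theorem on the Hodge
group of a Hodge structure of K3 type (Yu. G. Zarhin, *Hodge groups of K3 surfaces*, J. reine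
angew. Math. 341 (1983), Thm. 2.2.1–2.3.1; D. Huybrechts, *Lectures on K3 Surfaces*, Thm. 3.3.9:
"The other inclusion is deduced from a comparison of dimensions"): in the application `V = T_ℂ`,
`S = Lie(Hdg T)_ℂ`, `W = T_σ` an eigenspace of the totally real field `End_Hdg(T)`,
`e ∈ T^{2,0}`, `f ∈ T^{0,2}` and `2 e ∧ f = Θ` is the infinitesimal generator of `h(U(1))`.
Zarhin's printed argument uses the semisimplicity of `Hdg` and representation theory (minuscule
weights); the tree's DEVIATION is the following elementary argument, recorded here. Grade `S` by
`ad(e ∧ f)` (eigenvalues `1, 0, -1` on `e ∧ u`, `u ∧ u'`, `f ∧ v` for `u, u', v ∈ W₀ = W ∩ ⟨e,f⟩^⊥`):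
every `X ∈ S` decomposes as `B(Xe,f) e∧f + e∧u_X + f∧v_X + Z_X` with each summand in `S`.
With `A₊ = {u ∈ W₀ | e∧u ∈ S}`, `A₋ = {v ∈ W₀ | f∧v ∈ S}`: the subspace `Ke + (A₊ + A₋) + Kf` is
`S`-stable, so `A₊ + A₋ ⊇ W₀`; `Ke + A₋` is `S`-stable as soon as `A₋` is isotropic, which
irreducibility forbids, so `A₋` (and likewise `A₊`) carries a non-zero value of `B`; and the
bracket `[e∧u, f∧v] = -B(u,v) e∧f - u∧v` puts `u∧v` in `S`, whose action forces
`A₊ ⊆ A₋ ⊆ A₊`. Hence `A₊ = A₋ ⊇ W₀` and all `x ∧ y`, `x, y ∈ W`, lie in `S`. No definitions,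
no named facts.

## References

* Yu. G. Zarhin, *Hodge groups of K3 surfaces*, J. reine angew. Math. 341 (1983) 193–220, §2.
* D. Huybrechts, *Lectures on K3 Surfaces* (CUP 2016), Ch. 3, Thm. 3.3.9 and its proof sketch.
-/

noncomputable section

namespace Literature.AlgebraicGeometry.Motives

namespace ZarhinLie

universe u v

variable {K : Type u} [Field K] {V : Type v} [AddCommGroup V] [Module K V]
  (B : LinearMap.BilinForm K V)

/-- `so⟦x, y⟧ = x ∧ y : w ↦ B(y,w) x - B(x,w) y` (local notation for this file and its users). -/
local notation "so⟦" x ", " y "⟧" =>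
  (LinearMap.smulRight (B y) x - LinearMap.smulRight (B x) y : Module.End K V)

/-! ### The wedge elements `x ∧ y ∈ so(V, B)` -/

/-- `(x ∧ y) w = B(y, w) x - B(x, w) y`. [folklore] -/
theorem wedge_apply (x y w : V) : so⟦x, y⟧ w = B y w • x - B x w • y := by
  simp [LinearMap.smulRight_apply]

/-- `x ∧ x = 0`. [folklore] -/
theorem wedge_self (x : V) : so⟦x, x⟧ = 0 := sub_self _

/-- `y ∧ x = -(x ∧ y)`. [folklore] -/
theorem wedge_swap (x y : V) : so⟦y, x⟧ = -so⟦x, y⟧ := (neg_sub _ _).symm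

/-- `x ∧ y` is additive in `x`. [folklore] -/
theorem wedge_add_left (x x' y : V) : so⟦x + x', y⟧ = so⟦x, y⟧ + so⟦x', y⟧ := by
  ext w
  simp only [LinearMap.sub_apply, LinearMap.add_apply, LinearMap.smulRight_apply, map_add]
  module

/-- `x ∧ y` is additive in `y`. [folklore] -/
theorem wedge_add_right (x y y' : V) : so⟦x, y + y'⟧ = so⟦x, y⟧ + so⟦x, y'⟧ := by
  ext w
  simp only [LinearMap.sub_apply, LinearMap.add_apply, LinearMap.smulRight_apply, map_add]
  module

/-- `x ∧ y` is homogeneous in `x`. [folklore] -/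
theorem wedge_smul_left (c : K) (x y : V) : so⟦c • x, y⟧ = c • so⟦x, y⟧ := by
  ext w
  simp only [LinearMap.sub_apply, LinearMap.smul_apply, LinearMap.smulRight_apply, map_smul]
  module

/-- `x ∧ y` is homogeneous in `y`. [folklore] -/
theorem wedge_smul_right (c : K) (x y : V) : so⟦x, c • y⟧ = c • so⟦x, y⟧ := by
  ext w
  simp only [LinearMap.sub_apply, LinearMap.smul_apply, LinearMap.smulRight_apply, map_smul]
  module

/-- `x ∧ y` vanishes in `x` when `x = 0`. [folklore] -/
theorem wedge_zero_left (y : V) : so⟦(0 : V), y⟧ = 0 := by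
  ext w; simp

/-- `x ∧ y` vanishes when `y = 0`. [folklore] -/
theorem wedge_zero_right (x : V) : so⟦x, (0 : V)⟧ = 0 := by
  ext w; simp

/-- `x ∧ y` is subtractive in `x`. [folklore] -/
theorem wedge_sub_left (x x' y : V) : so⟦x - x', y⟧ = so⟦x, y⟧ - so⟦x', y⟧ := by
  ext w
  simp only [LinearMap.sub_apply, LinearMap.smulRight_apply, map_sub]
  module

/-- `x ∧ y` is subtractive in `y`. [folklore] -/
theorem wedge_sub_right (x y y' : V) : so⟦x, y - y'⟧ = so⟦x, y⟧ - so⟦x, y'⟧ := by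
  ext w
  simp only [LinearMap.sub_apply, LinearMap.smulRight_apply, map_sub]
  module

/-- `x ∧ y` is `B`-skew for symmetric `B`: `B((x∧y) w, w') = -B(w, (x∧y) w')`. [folklore] -/
theorem wedge_skew (hB : ∀ x y, B x y = B y x) (x y w w' : V) :
    B (so⟦x, y⟧ w) w' = -B w (so⟦x, y⟧ w') := by
  simp only [LinearMap.sub_apply, LinearMap.smulRight_apply, map_sub, map_smul, smul_eq_mul,
    LinearMap.smul_apply]
  rw [hB w x, hB w y]
  ring

/-- A skew `Z` brackets with a wedge by acting on its factors:
`Z (x∧y) - (x∧y) Z = (Zx)∧y + x∧(Zy)` (equivariance of `Λ² V → so(V)`). [folklore] -/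
theorem commutator_wedge (Z : Module.End K V) (hZ : ∀ w w', B (Z w) w' = -B w (Z w')) (x y : V) :
    Z * so⟦x, y⟧ - so⟦x, y⟧ * Z = so⟦Z x, y⟧ + so⟦x, Z y⟧ := by
  ext w
  simp only [LinearMap.sub_apply, Module.End.mul_apply, LinearMap.add_apply,
    LinearMap.smulRight_apply, map_sub, map_smul, hZ x w, hZ y w]
  module

/-- **The bracket of two wedges**:
`[x∧y, z∧w] = B(y,z) x∧w - B(y,w) x∧z - B(x,z) y∧w + B(x,w) y∧z`. [folklore] -/
theorem commutator_wedge_wedge (hB : ∀ x y, B x y = B y x) (x y z w : V) :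
    so⟦x, y⟧ * so⟦z, w⟧ - so⟦z, w⟧ * so⟦x, y⟧ =
      B y z • so⟦x, w⟧ - B y w • so⟦x, z⟧ - B x z • so⟦y, w⟧ + B x w • so⟦y, z⟧ := by
  ext v
  simp only [LinearMap.sub_apply, Module.End.mul_apply, LinearMap.add_apply,
    LinearMap.smul_apply, LinearMap.smulRight_apply, map_sub, map_smul]
  rw [hB z y, hB z x, hB w y, hB w x]
  module

/-! ### The Hodge element `E = e ∧ f` of a hyperbolic pair -/

section Setting

variable {B}

/-- `E e = e` when `B(e,e) = 0`, `B(f,e) = 1`. [folklore] -/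
theorem hodgeElt_apply_e {e f : V} (hee : B e e = 0) (hfe : B f e = 1) : so⟦e, f⟧ e = e := by
  rw [wedge_apply, hfe, hee, one_smul, zero_smul, sub_zero]

/-- `E f = -f` when `B(f,f) = 0`, `B(e,f) = 1`. [folklore] -/
theorem hodgeElt_apply_f {e f : V} (hff : B f f = 0) (hef : B e f = 1) : so⟦e, f⟧ f = -f := by
  rw [wedge_apply, hff, hef, zero_smul, one_smul, zero_sub]

/-- `E w = 0` for `w ⊥ e, f`. [folklore] -/
theorem hodgeElt_apply_of_orth {e f w : V} (hwe : B e w = 0) (hwf : B f w = 0) :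
    so⟦e, f⟧ w = 0 := by
  rw [wedge_apply, hwe, hwf, zero_smul, zero_smul, sub_zero]

/-- `(e ∧ u) e = 0` for `u ⊥ e`, `e` isotropic. [folklore] -/
theorem wedge_e_apply_e {e u : V} (hee : B e e = 0) (hue : B u e = 0) : so⟦e, u⟧ e = 0 := by
  rw [wedge_apply, hue, hee, zero_smul, zero_smul, sub_zero]

/-- `(e ∧ u) f = -u` for `u ⊥ f`, `B(e,f) = 1`. [folklore] -/
theorem wedge_e_apply_f {e f u : V} (hef : B e f = 1) (huf : B u f = 0) : so⟦e, u⟧ f = -u := by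
  rw [wedge_apply, huf, hef, zero_smul, one_smul, zero_sub]

/-- `(e ∧ u) w = B(u,w) e` for `w ⊥ e`. [folklore] -/
theorem wedge_e_apply_of_orth {e u w : V} (hew : B e w = 0) : so⟦e, u⟧ w = B u w • e := by
  rw [wedge_apply, hew, zero_smul, sub_zero]

end Setting

/-! ### Skew Lie subalgebras containing the Hodge element; the main theorem -/

section Graded

variable {B} [CharZero K] (hB : ∀ x y, B x y = B y x)
  {S : Submodule K (Module.End K V)}
  (hS_lie : ∀ X ∈ S, ∀ Y ∈ S, X * Y - Y * X ∈ S)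
  (hS_skew : ∀ X ∈ S, ∀ w w', B (X w) w' = -B w (X w'))
  {e f : V} (hee : B e e = 0) (hff : B f f = 0) (hef : B e f = 1)
  (hE : (LinearMap.smulRight (B f) e - LinearMap.smulRight (B e) f : Module.End K V) ∈ S)

include hB hS_skew in
/-- A skew `X` satisfies `B(X w, w) = 0` (characteristic `0`). [folklore] -/
theorem form_apply_self_eq_zero {X : Module.End K V} (hX : X ∈ S) (w : V) : B (X w) w = 0 := by
  have h := hS_skew X hX w w
  rw [hB w (X w)] at h
  exact add_self_eq_zero.1 (eq_neg_iff_add_eq_zero.1 h)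

omit [CharZero K] in
include hB hS_skew in
/-- `B(Xf, e) = -B(Xe, f)` for skew `X`. [folklore] -/
theorem form_apply_f_e {X : Module.End K V} (hX : X ∈ S) : B (X f) e = -B (X e) f := by
  rw [hS_skew X hX f e, hB f (X e)]

include hB hS_lie hS_skew hee hff hef hE in
/-- **The graded components of `X ∈ S` lie in `S`.** With `E = e ∧ f ∈ S`, `α = B(Xe, f)`,
`u_X = B(Xf,e) f - Xf`, `v_X = α e - Xe`: `[E, X] = e∧u_X - f∧v_X` and `[E,[E,X]] = e∧u_X + f∧v_X`,
so `e ∧ u_X ∈ S` and `f ∧ v_X ∈ S` (characteristic `0`). [folklore] -/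
theorem wedge_uPart_mem_and_wedge_vPart_mem {X : Module.End K V} (hX : X ∈ S) :
    so⟦e, B (X f) e • f - X f⟧ ∈ S ∧ so⟦f, B (X e) f • e - X e⟧ ∈ S := by
  have hfe : B f e = 1 := (hB f e).trans hef
  have hXfe := form_apply_f_e hB hS_skew hX (e := e) (f := f)
  set E := so⟦e, f⟧ with hEdef
  set P := so⟦e, B (X f) e • f - X f⟧ with hP
  set Q := so⟦f, B (X e) f • e - X e⟧ with hQ
  clear_value E P Q
  -- `[E, X] = P - Q`
  have hD₁ : E * X - X * E = P - Q := by
    ext w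
    simp only [hEdef, hP, hQ, LinearMap.sub_apply, Module.End.mul_apply,
      LinearMap.smulRight_apply, map_sub, map_smul, smul_eq_mul, LinearMap.smul_apply]
    rw [hS_skew X hX f w, hS_skew X hX e w, hXfe]
    module
  -- `[E, P] = P`, `[E, Q] = -Q`
  have hEP : E * P - P * E = P := by
    ext w
    simp only [hEdef, hP, LinearMap.sub_apply, Module.End.mul_apply,
      LinearMap.smulRight_apply, map_sub, map_smul, smul_eq_mul, LinearMap.smul_apply]
    rw [hS_skew X hX f w, hXfe, hfe, hef, hee, hff, hB e (X f), hXfe,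
      hB f (X f), form_apply_self_eq_zero hB hS_skew hX f, hB e w, hB f w]
    module
  have hEQ : E * Q - Q * E = -Q := by
    ext w
    simp only [hEdef, hQ, LinearMap.sub_apply, Module.End.mul_apply, LinearMap.neg_apply,
      LinearMap.smulRight_apply, map_sub, map_smul, smul_eq_mul, LinearMap.smul_apply]
    rw [hS_skew X hX e w, hfe, hef, hee, hff, hB f (X e),
      hB e (X e), form_apply_self_eq_zero hB hS_skew hX e, hB e w, hB f w]
    module
  have hD₂ : E * (P - Q) - (P - Q) * E = P + Q := by
    rw [mul_sub, sub_mul, sub_sub_sub_comm, hEP, hEQ, sub_neg_eq_add]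
  have hmem₁ : P - Q ∈ S := hD₁ ▸ hS_lie _ hE X hX
  have hmem₂ : P + Q ∈ S := hD₂ ▸ hS_lie _ hE _ hmem₁
  have h2 : (2 : K) ≠ 0 := two_ne_zero
  refine ⟨?_, ?_⟩
  · have : P = (2 : K)⁻¹ • ((P + Q) + (P - Q)) := by
      rw [show (P + Q) + (P - Q) = (2 : K) • P by rw [two_smul]; abel, smul_smul,
        inv_mul_cancel₀ h2, one_smul]
    rw [this]
    exact S.smul_mem _ (S.add_mem hmem₂ hmem₁)
  · have : Q = (2 : K)⁻¹ • ((P + Q) - (P - Q)) := by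
      rw [show (P + Q) - (P - Q) = (2 : K) • Q by rw [two_smul]; abel, smul_smul,
        inv_mul_cancel₀ h2, one_smul]
    rw [this]
    exact S.smul_mem _ (S.sub_mem hmem₂ hmem₁)

include hB hS_lie hS_skew hee hff hef hE in
/-- **The degree-`0` component `Z_X = X - α E - e∧u_X - f∧v_X` of `X ∈ S` (`α = B(Xe,f)`) lies in
`S` and kills `e` and `f`.** [folklore] -/
theorem zPart_mem {X : Module.End K V} (hX : X ∈ S) :
    X - B (X e) f • so⟦e, f⟧ - so⟦e, B (X f) e • f - X f⟧ - so⟦f, B (X e) f • e - X e⟧ ∈ S ∧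
    (X - B (X e) f • so⟦e, f⟧ - so⟦e, B (X f) e • f - X f⟧ - so⟦f, B (X e) f • e - X e⟧) e = 0 ∧
    (X - B (X e) f • so⟦e, f⟧ - so⟦e, B (X f) e • f - X f⟧ - so⟦f, B (X e) f • e - X e⟧) f = 0 := by
  have hfe : B f e = 1 := (hB f e).trans hef
  have hXfe := form_apply_f_e hB hS_skew hX (e := e) (f := f)
  obtain ⟨hP, hQ⟩ := wedge_uPart_mem_and_wedge_vPart_mem hB hS_lie hS_skew hee hff hef hE hX
  refine ⟨S.sub_mem (S.sub_mem (S.sub_mem hX (S.smul_mem _ hE)) hP) hQ, ?_, ?_⟩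
  · simp only [LinearMap.sub_apply, LinearMap.smul_apply, LinearMap.smulRight_apply, map_sub,
      map_smul, smul_eq_mul]
    rw [hfe, hee, form_apply_self_eq_zero hB hS_skew hX e]
    module
  · simp only [LinearMap.sub_apply, LinearMap.smul_apply, LinearMap.smulRight_apply, map_sub,
      map_smul, smul_eq_mul]
    rw [hef, hff, form_apply_self_eq_zero hB hS_skew hX f, hXfe]
    module

omit [CharZero K] in
include hB hS_lie hS_skew in
/-- **The action of the degree-`0` part on the degree-`1` part.** If `Z ∈ S` kills `e`, and
`e ∧ u ∈ S`, then `e ∧ (Z u) ∈ S` (`[Z, e∧u] = (Ze)∧u + e∧(Zu)`), and `Z u ⊥ e`. [folklore] -/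
theorem wedge_e_apply_mem {Z : Module.End K V} (hZ : Z ∈ S) (hZe : Z e = 0) {u : V}
    (hu : so⟦e, u⟧ ∈ S) : so⟦e, Z u⟧ ∈ S ∧ B e (Z u) = 0 := by
  have hskew := hS_skew Z hZ
  refine ⟨?_, ?_⟩
  · have := hS_lie Z hZ _ hu
    rwa [commutator_wedge B Z hskew, hZe, wedge_zero_left, zero_add] at this
  · rw [hB, hskew, hZe, map_zero, neg_zero]

omit [CharZero K] in
include hS_skew in
/-- `Z u ⊥ f` when `Z ∈ S` kills `f`. [folklore] -/
theorem form_f_apply_eq_zero_of_apply_f {Z : Module.End K V} (hZ : Z ∈ S) (hZf : Z f = 0) (u : V)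
    (hB : ∀ x y, B x y = B y x) : B f (Z u) = 0 := by
  rw [hB, hS_skew Z hZ, hZf, map_zero, neg_zero]

omit [CharZero K] in
include hB hS_lie hef hE in
/-- **The bracket of the degree-`±1` parts**: for `u ⊥ f`, `v ⊥ e` with `e ∧ u ∈ S` and
`f ∧ v ∈ S`, `[e∧u, f∧v] = -B(u,v) e∧f - u∧v`, so `u ∧ v ∈ S`. [folklore] -/
theorem wedge_mem_of_wedge_e_mem_of_wedge_f_mem {u v : V} (huf : B f u = 0) (hve : B e v = 0)
    (hu : so⟦e, u⟧ ∈ S) (hv : so⟦f, v⟧ ∈ S) :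
    so⟦u, v⟧ ∈ S := by
  have h := hS_lie _ hu _ hv
  rw [commutator_wedge_wedge B hB, hB u f, huf, zero_smul, zero_sub, hef, one_smul, hve,
    zero_smul, add_zero] at h
  -- `h : -(B u v • E) - u∧v ∈ S`
  have : so⟦u, v⟧ = -((-(B u v • so⟦e, f⟧) - so⟦u, v⟧) + B u v • so⟦e, f⟧) := by abel
  rw [this]
  exact S.neg_mem (S.add_mem h (S.smul_mem _ hE))

include hB hS_lie hS_skew hee hff hef hE in
/-- **Zarhin's Lie-algebra lemma, orthogonal (totally real) case.** Let `S ⊆ End(V)` be a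
subspace closed under commutators and consisting of `B`-skew endomorphisms (`B` symmetric,
characteristic `0`), preserving a subspace `W`; let `e, f ∈ W` be isotropic with `B(e,f) = 1` and
`e ∧ f ∈ S`; and assume `W` is `S`-irreducible. Then `x ∧ y ∈ S` for all `x, y ∈ W`, i.e. `S`
contains `so(W, B|_W)` (extended by zero on `W^⊥`). In Zarhin's theorem (Huybrechts, *Lectures on
K3 Surfaces*, Thm. 3.3.9, "comparison of dimensions"; Zarhin 1983, Thm. 2.2.1) this is applied to
`S = Lie(Hdg)_ℂ`, `W = T_σ`, `2 e∧f = Θ`; the elementary proof replacing Zarhin's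
representation-theoretic argument is described in the module docstring.
[cite: Zarhin1983HodgeGroupsK3, Thm. 2.2.1] -/
theorem wedge_mem_of_irreducible {W : Submodule K V} (hSW : ∀ X ∈ S, ∀ w ∈ W, X w ∈ W)
    (he : e ∈ W) (hf : f ∈ W)
    (hirr : ∀ U : Submodule K V, U ≤ W → (∀ X ∈ S, ∀ u ∈ U, X u ∈ U) → U = ⊥ ∨ U = W)
    {x y : V} (hx : x ∈ W) (hy : y ∈ W) : so⟦x, y⟧ ∈ S := by
  have hfe : B f e = 1 := (hB f e).trans hef
  have he0 : e ≠ 0 := fun h => by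
    rw [h, map_zero] at hfe
    exact zero_ne_one hfe
  -- the subspaces `A₊ = {u ∈ W₀ | e∧u ∈ S}` and `A₋ = {v ∈ W₀ | f∧v ∈ S}`
  let Ap : Submodule K V :=
    { carrier := {u | u ∈ W ∧ B e u = 0 ∧ B f u = 0 ∧ so⟦e, u⟧ ∈ S}
      add_mem' := fun {a b} ha hb => ⟨W.add_mem ha.1 hb.1,
        by rw [map_add, ha.2.1, hb.2.1, add_zero], by rw [map_add, ha.2.2.1, hb.2.2.1, add_zero],
        by rw [wedge_add_right]; exact S.add_mem ha.2.2.2 hb.2.2.2⟩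
      zero_mem' := ⟨W.zero_mem, by rw [map_zero], by rw [map_zero],
        by rw [wedge_zero_right]; exact S.zero_mem⟩
      smul_mem' := fun c a ha => ⟨W.smul_mem c ha.1, by rw [map_smul, ha.2.1, smul_zero],
        by rw [map_smul, ha.2.2.1, smul_zero],
        by rw [wedge_smul_right]; exact S.smul_mem c ha.2.2.2⟩ }
  let Am : Submodule K V :=
    { carrier := {v | v ∈ W ∧ B e v = 0 ∧ B f v = 0 ∧ so⟦f, v⟧ ∈ S}
      add_mem' := fun {a b} ha hb => ⟨W.add_mem ha.1 hb.1,
        by rw [map_add, ha.2.1, hb.2.1, add_zero], by rw [map_add, ha.2.2.1, hb.2.2.1, add_zero],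
        by rw [wedge_add_right]; exact S.add_mem ha.2.2.2 hb.2.2.2⟩
      zero_mem' := ⟨W.zero_mem, by rw [map_zero], by rw [map_zero],
        by rw [wedge_zero_right]; exact S.zero_mem⟩
      smul_mem' := fun c a ha => ⟨W.smul_mem c ha.1, by rw [map_smul, ha.2.1, smul_zero],
        by rw [map_smul, ha.2.2.1, smul_zero],
        by rw [wedge_smul_right]; exact S.smul_mem c ha.2.2.2⟩ }
  have hAp : ∀ {u}, u ∈ Ap ↔ u ∈ W ∧ B e u = 0 ∧ B f u = 0 ∧ so⟦e, u⟧ ∈ S := Iff.rfl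
  have hAm : ∀ {v}, v ∈ Am ↔ v ∈ W ∧ B e v = 0 ∧ B f v = 0 ∧ so⟦f, v⟧ ∈ S := Iff.rfl
  -- (1) the components `u_X ∈ A₊`, `v_X ∈ A₋` of `X ∈ S`
  have hcomp : ∀ X ∈ S, B (X f) e • f - X f ∈ Ap ∧ B (X e) f • e - X e ∈ Am := fun X hX => by
    obtain ⟨hP, hQ⟩ := wedge_uPart_mem_and_wedge_vPart_mem hB hS_lie hS_skew hee hff hef hE hX
    refine ⟨⟨W.sub_mem (W.smul_mem _ hf) (hSW X hX f hf), ?_, ?_, hP⟩,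
      ⟨W.sub_mem (W.smul_mem _ he) (hSW X hX e he), ?_, ?_, hQ⟩⟩
    · rw [map_sub, map_smul, smul_eq_mul, hef, mul_one, hB e (X f), sub_self]
    · rw [map_sub, map_smul, smul_eq_mul, hff, mul_zero, zero_sub, neg_eq_zero, hB f (X f),
        form_apply_self_eq_zero hB hS_skew hX f]
    · rw [map_sub, map_smul, smul_eq_mul, hee, mul_zero, zero_sub, neg_eq_zero, hB e (X e),
        form_apply_self_eq_zero hB hS_skew hX e]
    · rw [map_sub, map_smul, smul_eq_mul, hfe, mul_one, hB f (X e), sub_self]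
  -- (2) the degree-`0` elements of `S` preserve `A₊` and `A₋`
  have hZact : ∀ Z ∈ S, Z e = 0 → Z f = 0 → (∀ u ∈ Ap, Z u ∈ Ap) ∧ (∀ v ∈ Am, Z v ∈ Am) := by
    intro Z hZ hZe hZf
    refine ⟨fun u hu => ?_, fun v hv => ?_⟩
    · obtain ⟨hmem, horth⟩ := wedge_e_apply_mem hB hS_lie hS_skew hZ hZe hu.2.2.2
      exact ⟨hSW Z hZ u hu.1, horth, form_f_apply_eq_zero_of_apply_f hS_skew hZ hZf u hB, hmem⟩
    · obtain ⟨hmem, horth⟩ := wedge_e_apply_mem hB hS_lie hS_skew hZ hZf hv.2.2.2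
      exact ⟨hSW Z hZ v hv.1, form_f_apply_eq_zero_of_apply_f hS_skew hZ hZe v hB, horth, hmem⟩
  -- (3) `u ∧ v ∈ S` kills `e`, `f` for `u ∈ A₊`, `v ∈ A₋`
  have huv : ∀ u ∈ Ap, ∀ v ∈ Am, so⟦u, v⟧ ∈ S ∧ so⟦u, v⟧ e = 0 ∧ so⟦u, v⟧ f = 0 := by
    intro u hu v hv
    refine ⟨wedge_mem_of_wedge_e_mem_of_wedge_f_mem hB hS_lie hef hE hu.2.2.1 hv.2.1 hu.2.2.2
      hv.2.2.2, ?_, ?_⟩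
    · rw [wedge_apply, hB v e, hv.2.1, hB u e, hu.2.1, zero_smul, zero_smul, sub_zero]
    · rw [wedge_apply, hB v f, hv.2.2.1, hB u f, hu.2.2.1, zero_smul, zero_smul, sub_zero]
  -- how `X ∈ S` acts on `e`, `f` and on `A₊`, `A₋`
  have hXe : ∀ X ∈ S, X e = B (X e) f • e - (B (X e) f • e - X e) := fun X _ => by abel
  have hXf : ∀ X ∈ S, X f = B (X f) e • f - (B (X f) e • f - X f) := fun X _ => by abel
  have hXu : ∀ X ∈ S, ∀ u, B e u = 0 → B f u = 0 →
      X u = B (B (X f) e • f - X f) u • e + B (B (X e) f • e - X e) u • f +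
        (X - B (X e) f • so⟦e, f⟧ - so⟦e, B (X f) e • f - X f⟧ - so⟦f, B (X e) f • e - X e⟧) u := by
    intro X _ u hue huf
    simp only [LinearMap.sub_apply, LinearMap.smul_apply, LinearMap.smulRight_apply, map_sub,
      map_smul, smul_eq_mul, hue, huf]
    module
  have hZ : ∀ X (hX : X ∈ S), _ := fun X hX => zPart_mem hB hS_lie hS_skew hee hff hef hE hX
  -- membership of the pieces in a subspace containing `e`, `f`, stable pieces
  -- (4) `W₀ ⊆ A₊ + A₋`, via the `S`-stable subspace `Ke + (A₊ + A₋) + Kf`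
  have hApW : Ap ≤ W := fun u hu => hu.1
  have hAmW : Am ≤ W := fun v hv => hv.1
  have hstab : ∀ (U : Submodule K V), e ∈ U → f ∈ U →
      (∀ X ∈ S, ∀ u ∈ Ap, X u ∈ U) → (∀ X ∈ S, ∀ v ∈ Am, X v ∈ U) →
      (Ap ≤ U) → (Am ≤ U) → ∀ X ∈ S, ∀ w ∈ (K ∙ e) ⊔ (Ap ⊔ Am) ⊔ (K ∙ f), X w ∈ U := by
    intro U heU hfU hXAp hXAm hApU hAmU X hX w hw
    obtain ⟨w₁, hw₁, w₂, hw₂, rfl⟩ := Submodule.mem_sup.1 hw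
    obtain ⟨w₃, hw₃, w₄, hw₄, rfl⟩ := Submodule.mem_sup.1 hw₁
    obtain ⟨w₅, hw₅, w₆, hw₆, rfl⟩ := Submodule.mem_sup.1 hw₄
    obtain ⟨a, rfl⟩ := Submodule.mem_span_singleton.1 hw₃
    obtain ⟨b, rfl⟩ := Submodule.mem_span_singleton.1 hw₂
    rw [map_add, map_add, map_add, map_smul, map_smul]
    refine U.add_mem (U.add_mem (U.smul_mem _ ?_) (U.add_mem (hXAp X hX _ hw₅) (hXAm X hX _ hw₆)))
      (U.smul_mem _ ?_)
    · rw [hXe X hX]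
      exact U.sub_mem (U.smul_mem _ heU) (hAmU (hcomp X hX).2)
    · rw [hXf X hX]
      exact U.sub_mem (U.smul_mem _ hfU) (hApU (hcomp X hX).1)
  have hW₀ : ∀ w ∈ W, B e w = 0 → B f w = 0 → w ∈ Ap ⊔ Am := by
    set U := (K ∙ e) ⊔ (Ap ⊔ Am) ⊔ (K ∙ f) with hU
    have hUW : U ≤ W := sup_le (sup_le ((Submodule.span_singleton_le_iff_mem e W).2 he)
      (sup_le hApW hAmW)) ((Submodule.span_singleton_le_iff_mem f W).2 hf)
    have heU : e ∈ U := Submodule.mem_sup_left (Submodule.mem_sup_left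
      (Submodule.mem_span_singleton_self e))
    have hfU : f ∈ U := Submodule.mem_sup_right (Submodule.mem_span_singleton_self f)
    have hApU : Ap ≤ U := le_sup_of_le_left (le_sup_of_le_right le_sup_left)
    have hAmU : Am ≤ U := le_sup_of_le_left (le_sup_of_le_right le_sup_right)
    have hUstab : ∀ X ∈ S, ∀ w ∈ U, X w ∈ U := by
      refine hstab U heU hfU (fun X hX u hu => ?_) (fun X hX v hv => ?_) hApU hAmU
      · rw [hXu X hX u hu.2.1 hu.2.2.1]
        exact U.add_mem (U.add_mem (U.smul_mem _ heU) (U.smul_mem _ hfU))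
          (hApU (((hZact _ (hZ X hX).1 (hZ X hX).2.1 (hZ X hX).2.2)).1 u hu))
      · rw [hXu X hX v hv.2.1 hv.2.2.1]
        exact U.add_mem (U.add_mem (U.smul_mem _ heU) (U.smul_mem _ hfU))
          (hAmU (((hZact _ (hZ X hX).1 (hZ X hX).2.1 (hZ X hX).2.2)).2 v hv))
    rcases hirr U hUW hUstab with h | h
    · exact absurd (h ▸ heU : e ∈ (⊥ : Submodule K V)) (by simpa using he0)
    intro w hw hwe hwf
    rw [← h] at hw
    obtain ⟨w₁, hw₁, w₂, hw₂, rfl⟩ := Submodule.mem_sup.1 hw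
    obtain ⟨w₃, hw₃, m, hm, rfl⟩ := Submodule.mem_sup.1 hw₁
    obtain ⟨a, rfl⟩ := Submodule.mem_span_singleton.1 hw₃
    obtain ⟨b, rfl⟩ := Submodule.mem_span_singleton.1 hw₂
    -- `m ⊥ e, f`
    have hm' : B e m = 0 ∧ B f m = 0 := by
      obtain ⟨u, hu, v, hv, rfl⟩ := Submodule.mem_sup.1 hm
      exact ⟨by rw [map_add, hu.2.1, hv.2.1, add_zero], by rw [map_add, hu.2.2.1, hv.2.2.1, add_zero]⟩
    have ha : a = 0 := by
      have := hwf
      rw [map_add, map_add, map_smul, map_smul, smul_eq_mul, smul_eq_mul, hfe, hm'.2, hff] at this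
      simpa using this
    have hb : b = 0 := by
      have := hwe
      rw [map_add, map_add, map_smul, map_smul, smul_eq_mul, smul_eq_mul, hee, hm'.1, hef] at this
      simpa using this
    rw [ha, hb, zero_smul, zero_add, zero_smul, add_zero]
    exact hm
  -- (5) `A₋` is not isotropic (else `Ke + A₋` would be a proper `S`-stable subspace), nor is `A₊`
  have hAm_aniso : ∃ v₁ ∈ Am, ∃ v₂ ∈ Am, B v₁ v₂ ≠ 0 := by
    by_contra hiso
    push Not at hiso
    set U := (K ∙ e) ⊔ Am with hU
    have hUW : U ≤ W := sup_le ((Submodule.span_singleton_le_iff_mem e W).2 he) hAmW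
    have heU : e ∈ U := Submodule.mem_sup_left (Submodule.mem_span_singleton_self e)
    have hAmU : Am ≤ U := le_sup_right
    have hUstab : ∀ X ∈ S, ∀ w ∈ U, X w ∈ U := by
      intro X hX w hw
      obtain ⟨w₁, hw₁, v, hv, rfl⟩ := Submodule.mem_sup.1 hw
      obtain ⟨a, rfl⟩ := Submodule.mem_span_singleton.1 hw₁
      rw [map_add, map_smul]
      refine U.add_mem (U.smul_mem _ ?_) ?_
      · rw [hXe X hX]
        exact U.sub_mem (U.smul_mem _ heU) (hAmU (hcomp X hX).2)
      · rw [hXu X hX v hv.2.1 hv.2.2.1, hiso _ (hcomp X hX).2 _ hv, zero_smul, add_zero]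
        exact U.add_mem (U.smul_mem _ heU)
          (hAmU (((hZact _ (hZ X hX).1 (hZ X hX).2.1 (hZ X hX).2.2)).2 v hv))
    rcases hirr U hUW hUstab with h | h
    · exact absurd (h ▸ heU : e ∈ (⊥ : Submodule K V)) (by simpa using he0)
    have hfU : f ∈ U := h ▸ hf
    obtain ⟨w₁, hw₁, v, hv, hsum⟩ := Submodule.mem_sup.1 hfU
    obtain ⟨a, rfl⟩ := Submodule.mem_span_singleton.1 hw₁
    have := congrArg (B e) hsum
    rw [map_add, map_smul, smul_eq_mul, hee, mul_zero, zero_add, hv.2.1, hef] at this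
    exact zero_ne_one this
  have hAp_aniso : ∃ u₁ ∈ Ap, ∃ u₂ ∈ Ap, B u₁ u₂ ≠ 0 := by
    by_contra hiso
    push Not at hiso
    set U := (K ∙ f) ⊔ Ap with hU
    have hUW : U ≤ W := sup_le ((Submodule.span_singleton_le_iff_mem f W).2 hf) hApW
    have hfU : f ∈ U := Submodule.mem_sup_left (Submodule.mem_span_singleton_self f)
    have hApU : Ap ≤ U := le_sup_right
    have hUstab : ∀ X ∈ S, ∀ w ∈ U, X w ∈ U := by
      intro X hX w hw
      obtain ⟨w₁, hw₁, u, hu, rfl⟩ := Submodule.mem_sup.1 hw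
      obtain ⟨a, rfl⟩ := Submodule.mem_span_singleton.1 hw₁
      rw [map_add, map_smul]
      refine U.add_mem (U.smul_mem _ ?_) ?_
      · rw [hXf X hX]
        exact U.sub_mem (U.smul_mem _ hfU) (hApU (hcomp X hX).1)
      · rw [hXu X hX u hu.2.1 hu.2.2.1, hiso _ (hcomp X hX).1 _ hu, zero_smul, zero_add]
        exact U.add_mem (U.smul_mem _ hfU)
          (hApU (((hZact _ (hZ X hX).1 (hZ X hX).2.1 (hZ X hX).2.2)).1 u hu))
    rcases hirr U hUW hUstab with h | h
    · refine absurd (h ▸ hfU : f ∈ (⊥ : Submodule K V)) ?_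
      rw [Submodule.mem_bot]
      intro hf0
      rw [hf0, map_zero] at hef
      exact zero_ne_one hef
    have heU : e ∈ U := h ▸ he
    obtain ⟨w₁, hw₁, u, hu, hsum⟩ := Submodule.mem_sup.1 heU
    obtain ⟨a, rfl⟩ := Submodule.mem_span_singleton.1 hw₁
    have := congrArg (B f) hsum
    rw [map_add, map_smul, smul_eq_mul, hff, mul_zero, zero_add, hu.2.2.1, hfe] at this
    exact zero_ne_one this
  -- (6) `A₊ ⊆ A₋` and `A₋ ⊆ A₊`
  obtain ⟨v₁, hv₁, v₂, hv₂, hv₁₂⟩ := hAm_aniso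
  obtain ⟨u₁, hu₁, u₂, hu₂, hu₁₂⟩ := hAp_aniso
  have hApAm : Ap ≤ Am := by
    intro u hu
    obtain ⟨hZmem, hZe', hZf'⟩ := huv u hu v₁ hv₁
    have h1 : so⟦u, v₁⟧ v₂ ∈ Am := (hZact _ hZmem hZe' hZf').2 v₂ hv₂
    rw [wedge_apply] at h1
    have h2 : B v₁ v₂ • u ∈ Am := by
      have := Am.add_mem h1 (Am.smul_mem (B u v₂) hv₁)
      rwa [sub_add_cancel] at this
    have h3 := Am.smul_mem (B v₁ v₂)⁻¹ h2
    rwa [smul_smul, inv_mul_cancel₀ hv₁₂, one_smul] at h3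
  have hAmAp : Am ≤ Ap := by
    intro v hv
    obtain ⟨hZmem, hZe', hZf'⟩ := huv u₁ hu₁ v hv
    have h1 : so⟦u₁, v⟧ u₂ ∈ Ap := (hZact _ hZmem hZe' hZf').1 u₂ hu₂
    rw [wedge_apply] at h1
    have h2 : B u₁ u₂ • v ∈ Ap := by
      have := Ap.sub_mem (Ap.smul_mem (B v u₂) hu₁) h1
      rwa [sub_sub_cancel] at this
    have h3 := Ap.smul_mem (B u₁ u₂)⁻¹ h2
    rwa [smul_smul, inv_mul_cancel₀ hu₁₂, one_smul] at h3
  -- (7) hence `W₀ ⊆ A₊ = A₋`: every `w ∈ W` with `w ⊥ e, f` has `e ∧ w, f ∧ w ∈ S`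
  have hW₀' : ∀ w ∈ W, B e w = 0 → B f w = 0 → w ∈ Ap ∧ w ∈ Am := by
    intro w hw hwe hwf
    have h := hW₀ w hw hwe hwf
    have hAp' : w ∈ Ap := (sup_le le_rfl hAmAp) h
    exact ⟨hAp', hApAm hAp'⟩
  -- (8) conclusion, by bilinearity from the decompositions `x = B(x,f) e + x₀ + B(x,e) f`
  have hdec : ∀ w ∈ W, w - B w f • e - B w e • f ∈ Ap ∧ w - B w f • e - B w e • f ∈ Am := by
    intro w hw
    refine hW₀' _ (W.sub_mem (W.sub_mem hw (W.smul_mem _ he)) (W.smul_mem _ hf)) ?_ ?_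
    · rw [map_sub, map_sub, map_smul, map_smul, smul_eq_mul, smul_eq_mul, hee, hef, mul_zero,
        sub_zero, mul_one, hB e w, sub_self]
    · rw [map_sub, map_sub, map_smul, map_smul, smul_eq_mul, smul_eq_mul, hfe, hff, mul_one,
        mul_zero, sub_zero, hB f w, sub_self]
  have hleft : ∀ p, (∀ q ∈ Ap, so⟦p, q⟧ ∈ S) → so⟦p, e⟧ ∈ S → so⟦p, f⟧ ∈ S →
      ∀ w ∈ W, so⟦p, w⟧ ∈ S := by
    intro p hpq hpe hpf w hw
    have hw' : w = B w f • e + (w - B w f • e - B w e • f) + B w e • f := by abel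
    rw [hw', wedge_add_right, wedge_add_right, wedge_smul_right, wedge_smul_right]
    exact S.add_mem (S.add_mem (S.smul_mem _ hpe) (hpq _ (hdec w hw).1)) (S.smul_mem _ hpf)
  have hx' : x = B x f • e + (x - B x f • e - B x e • f) + B x e • f := by abel
  rw [hx', wedge_add_left, wedge_add_left, wedge_smul_left, wedge_smul_left]
  refine S.add_mem (S.add_mem (S.smul_mem _ ?_) ?_) (S.smul_mem _ ?_)
  · -- `e ∧ y`
    refine hleft e (fun q hq => hq.2.2.2) ?_ hE y hy
    rw [wedge_self]; exact S.zero_mem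
  · -- `x₀ ∧ y`
    refine hleft _ (fun q hq => (huv _ (hdec x hx).1 q (hApAm hq)).1) ?_ ?_ y hy
    · rw [wedge_swap]; exact S.neg_mem (hdec x hx).1.2.2.2
    · rw [wedge_swap]; exact S.neg_mem (hdec x hx).2.2.2.2
  · -- `f ∧ y`
    refine hleft f (fun q hq => (hApAm hq).2.2.2) ?_ ?_ y hy
    · rw [wedge_swap]; exact S.neg_mem hE
    · rw [wedge_self]; exact S.zero_mem

end Graded

end ZarhinLie

end Literature.AlgebraicGeometry.Motives

end
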